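import Summits.BirchSwinnertonDyer.BirchSwinnertonDyer.Theorems.AlignedTransportAtTwoBSDOfMainConjectureRankOneAtTwoLeadingTermAlgebra
import Summits.BirchSwinnertonDyer.Rank1Residual.F1Sign2.TwoAdicBSDRankOneAtTwo
import Summits.BirchSwinnertonDyer.BirchSwinnertonDyer.Theorems.AlignedTransportAtTwoMainConjectureTransportAlignedAtTwoClosure
import Literature.NumberTheory.EllipticCurves.CanonicalPAdicHeightSqExistenceProofs
import Literature.NumberTheory.EllipticCurves.IwasawaLeadingTermProofs
import HarnessLib

/-!
# Route `AlignedTransportAtTwo`, crux C3′ `BSDOfMainConjectureRankOneAtTwo` (stmt-BirchSwinnertonDyer-23008), line `birth` — the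
# ALTERNATIVE closure through the cell's NAMED `2`-adic BSD statements (-es lens, filed p596807): K2-Gv `TwoAdicBSDValRankOneAt` +
# K2-G′v `TwoAdicShaAnTransferRankOneAt` on the cell ⟹ C3′ (by the slice-free norm-form Glue14, p595859 §6)

HONEST FRAMING (cell `bsd-f1-sign2`, lead seat `bsd-line-att-p1` g2). BSD is NOT proved; C3′ is NOT closed. THEOREMS ONLY; nothing asserted.
Two routes to C3′ now exist in the tree, SAME currency (REF1 §55: H1–H3 clean), DIFFERENT epistemic status:
* the MC-route (this seat's line): Schneider/BMS leading term of the CHARACTERISTIC SERIES at `2` (`F1Sign2.SchneiderLeadingTermAtTwoSq`, theorem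
  at odd `p`, conjecture at `2`) + Perrin-Riou's comparison at `2`, converted to `L₂` THROUGH the crux's own binders «Mazur's `2`-adic main
  conjecture» and «`ord_T L₂ = 1`» (adapter p594549; inline closure p595308; by-name closure pending the typer's `SchneiderPerrinRiouAtTwo.lean`);
* THIS file: the `L`-FUNCTION route — the cell's K2-Gv (`TwoAdicBSDValRankOneAt W`: `ord_T L₂ = 1` and the MTT/BMS leading-term identity for
  `L₂` itself in `2`-adic norm, i.e. BMS CONJECTURE 1.4 at `2` — conjecture-grade at EVERY `p`) and K2-G′v (`TwoAdicShaAnTransferRankOneAt W`: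
  `Reg₂ ≠ 0` and `#Ш_an ∈ ℚ` satisfies the same identity) on the cell curves give `BSDp W 2` by pure cancellation (`bsdp_of_normLeadingTerm_of_shaAnTransfer`),
  WITHOUT using the main-conjecture binder of C3′ (it is idle on this route — recorded, not hidden). Inputs besides the two conjectures: GZK,
  modularity (`exists_isNewformOf` for a newform; the period ratio `ϖ` from `realPeriodRat_eq_unit_mul_plusPeriod_two` — any `ϖ` with
  `ϖ·Ω_E = Ω⁺_f` does), the Mazur–Tate `Σ²` fact (height receptacle). `--supports stmt-BirchSwinnertonDyer-23008`; closes nothing.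
[cite: BalakrishnanMullerStein2015, Conj. 1.4 and Thm. 1.7] [cite: PerrinRiou1987] [cite: MazurTate1991, Thm. 3.1] [cite: Miller2011LMS, Def. 1.1]
-/

set_option autoImplicit false
-- the route's Theorems namespace repeats a component by design (summit = sub-problem, D-0017).
set_option linter.dupNamespace false

noncomputable section

open scoped Classical MatrixGroups ModularForm

open CongruenceSubgroup WeierstrassCurve Literature.NumberTheory.EllipticCurves
  Literature.NumberTheory.EllipticCurves.ModularForms Literature.NumberTheory.EllipticCurves.Greenberg1999
  Summit.BirchSwinnertonDyer.Rank1Residual.F1Sign2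
  Summit.BirchSwinnertonDyer.BirchSwinnertonDyer.Theorems.AlignedTransportAtTwoLeadingTermAlgebra

namespace Summit.BirchSwinnertonDyer.BirchSwinnertonDyer.Theorems.AlignedTransportAtTwoLeadingTermViaTwoAdicBSD

/-- **C3′ from the cell's K2-Gv and K2-G′v on the cell curves + GZK + modularity + period ratio + the `Σ²` fact (CONDITIONAL; closes
nothing; the main-conjecture binder of C3′ is idle on this route).** For each cell curve: GZK gives `rank = 1` and `Ш` finite; modularity a
newform `f` (conductor level) and `hper` a rational `ϖ` with `ϖ·Ω_E = Ω⁺_f`; the `Σ²` fact THE canonical datum `D`; K2-Gv at `(D, f, ϖ)` the norm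
identity with `#Ш[2^∞]`, K2-G′v the one with `#Ш_an = q` and `Reg₂(D) ≠ 0`; with `X = (1−α⁻¹)²·Reg₂(D)·∏c_v ≠ 0` (`1−α⁻¹ = u·#Ẽ(𝔽₂)`,
`exists_unit_one_sub_unitRoot_inv`) the slice-free Glue14 `bsdp_of_normLeadingTerm_of_shaAnTransfer` concludes.
[cite: BalakrishnanMullerStein2015, Conj. 1.4] [cite: PerrinRiou1987] [cite: Miller2011LMS, Def. 1.1] -/
theorem bsdOfMainConjectureRankOneAtTwo_of_twoAdicBSDValAt_of_shaAnTransferAt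
    (hGv : ∀ (W : WeierstrassCurve ℚ) [W.IsElliptic] [W.IsGloballyMinimal],
      ¬ W.HasCM → (∀ x : ℚ, ¬ HasRationalTwoTorsionX W x) → ¬ IsSquare W.Δ → TwoAdicBSDValRankOneAt W)
    (hG'v : ∀ (W : WeierstrassCurve ℚ) [W.IsElliptic] [W.IsGloballyMinimal],
      ¬ W.HasCM → (∀ x : ℚ, ¬ HasRationalTwoTorsionX W x) → ¬ IsSquare W.Δ → TwoAdicShaAnTransferRankOneAt W)
    (hGZK : rank_eq_analyticRank_of_analyticRank_le_one) (hmod : exists_isNewformOf)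
    (hper : realPeriodRat_eq_unit_mul_plusPeriod_two) (hMT : mazurTate_sigmaSq_existsUnique_two) :
    Summit.BirchSwinnertonDyer.BirchSwinnertonDyer.Theses.AlignedTransportAtTwo.BSDOfMainConjectureRankOneAtTwo := by
  intro W _ _ hcm hord ht hsq hr _ _
  haveI : NeZero (W.conductorNorm ℤ) := ⟨(W.conductorNorm_pos_holds).ne'⟩
  -- GZK: rank one and `Ш` finite
  obtain ⟨-, hfin⟩ := hGZK W (le_of_eq hr)
  haveI : Finite W.sha := hfin
  haveI hfinp : Finite (AddCommGroup.primaryComponent W.sha 2) := inferInstance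
  -- newform, period ratio, canonical `Σ²` datum
  obtain ⟨f, hf⟩ := hmod W
  have hirr : W.HasIrreducibleModPGaloisRep 2 :=
    Summit.BirchSwinnertonDyer.BirchSwinnertonDyer.Theorems.AlignedTransportAtTwoClosure.irr_two_of_forall_not_hasRationalTwoTorsionX
      W ht
  obtain ⟨ϖ, hϖ⟩ :=
    Summit.BirchSwinnertonDyer.BirchSwinnertonDyer.Theorems.AlignedTransportAtTwoClosure.exists_periodRatio_two W hper hord.1 hirr hf
  obtain ⟨D, hD⟩ := exists_isCanonicalSq_two hMT W hord.1 hord.2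
  -- the two laws at `(D, f, ϖ)`
  obtain ⟨-, hLT⟩ := hGv W hcm ht hsq hord hr D hD f hf
  have hLT' := hLT hfinp ϖ hϖ
  obtain ⟨hReg, q, hq, hCMP⟩ := hG'v W hcm ht hsq hord hr D hD f hf ϖ hϖ
  -- `X = ε₂ · Reg₂ · Tam ≠ 0`
  set ε : ℚ_[2] := (1 - (unitRoot W 2 : ℚ_[2])⁻¹) ^ 2 with hε
  have hε0 : ε ≠ 0 := by
    obtain ⟨u₂, hu₂⟩ := exists_unit_one_sub_unitRoot_inv 2 W hord
    have hN : (W.reductionPointCount 2 : ℚ_[2]) ≠ 0 := by exact_mod_cast (W.reductionPointCount_pos 2).ne'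
    have hu1 : ‖((u₂ : ℤ_[2]) : ℚ_[2])‖ = 1 := PadicInt.isUnit_iff.mp u₂.isUnit
    have hu0 : ((u₂ : ℤ_[2]) : ℚ_[2]) ≠ 0 := by
      rw [← norm_pos_iff, hu1]; exact one_pos
    rw [hε, hu₂]
    exact pow_ne_zero 2 (mul_ne_zero hu0 hN)
  have hc0 : (W.tamagawaProduct : ℚ_[2]) ≠ 0 := by exact_mod_cast (W.tamagawaProduct_pos_holds).ne'
  have hX : ε * padicRegulator D * (W.tamagawaProduct : ℚ_[2]) ≠ 0 := mul_ne_zero (mul_ne_zero hε0 hReg) hc0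
  set A : ℚ_[2] := (ϖ : ℚ_[2]) * PowerSeries.coeff 1 (padicLFunction f (unitRoot W 2 : ℚ_[2])) *
      padicLog 2 (cyclotomicGenerator 2) * (W.torsionOrder : ℚ_[2]) ^ 2 with hA
  have hLT'' : ‖A‖ = ‖(Nat.card (AddCommGroup.primaryComponent W.sha 2) : ℚ_[2]) *
      (ε * padicRegulator D * (W.tamagawaProduct : ℚ_[2]))‖ := by
    rw [hA, hLT']
    congr 1
    ring
  have hCMP'' : ‖A‖ = ‖(q : ℚ_[2]) * (ε * padicRegulator D * (W.tamagawaProduct : ℚ_[2]))‖ := by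
    rw [hA, hCMP]
    congr 1
    ring
  exact bsdp_of_normLeadingTerm_of_shaAnTransfer 2 W hGZK (le_of_eq hr) hX hLT'' ⟨q, hq, hCMP''⟩

end Summit.BirchSwinnertonDyer.BirchSwinnertonDyer.Theorems.AlignedTransportAtTwoLeadingTermViaTwoAdicBSD

end
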